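import Mathlib
import Summits.KontsevichZagierPeriods.KontsevichZagierPeriods.Theorems.SoloInformedCoonsPatch
import Summits.KontsevichZagierPeriods.KontsevichZagierPeriods.Theorems.SoloInformedLineDerivKit
import HarnessLib

/-!
# SoloInformed — the pulled-back form `G(h) dh` along a Coons patch: coefficients and closedness

File I2b₁ (derivative part) of the (HT) step.  For `G : ℂ → ℂ` and a Coons patch
`h = soloInformedCoons cB cT cL cR` write, in the coordinates `s = z 0`, `t = z 1` of `ℝ²`,
`P = Re(G(h)·∂ₛh)`, `Q = Re(G(h)·∂ₜh)` (and the `Im` versions).  If `G` is complex-differentiable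
at `h(z)` and the edge curves are differentiable, then `P` has the line derivative
`Pₜ = Re(G′(h) ∂ₜh ∂ₛh + G(h) ∂ₜ∂ₛh)` along `e₁` and `Q` the line derivative
`Qₛ = Re(G′(h) ∂ₛh ∂ₜh + G(h) ∂ₛ∂ₜh)` along `e₀` (`soloInformed_hasLineDerivAt_coonsP/Q`), and
`Pₜ = Qₛ` identically (`soloInformed_coonsPt_eq_Qs`) — the hypotheses `hPd`, `hQd`, `hclosed` of
`soloInformed_kzGreen_line`, obtained from FIRST derivatives of the edge curves only.
-/

noncomputable section

namespace Summit.KontsevichZagierPeriods.KontsevichZagierPeriods.Theorems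

open Set

section Defs

variable (G G' : ℂ → ℂ) (cB cT cL cR dB dT dL dR : ℝ → ℂ)

/-- `G(h)·∂ₛh` at `(z 0, z 1)` (complex). -/
def soloInformedCoonsPc (z : Fin 2 → ℝ) : ℂ :=
  G (soloInformedCoons cB cT cL cR (z 0) (z 1)) *
    soloInformedCoonsDs cB cT cL cR dB dT (z 0) (z 1)

/-- `G(h)·∂ₜh` at `(z 0, z 1)` (complex). -/
def soloInformedCoonsQc (z : Fin 2 → ℝ) : ℂ :=
  G (soloInformedCoons cB cT cL cR (z 0) (z 1)) * soloInformedCoonsDt cB cT dL dR (z 0) (z 1)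

/-- `∂ₜ(G(h)·∂ₛh) = G′(h) ∂ₜh ∂ₛh + G(h) ∂ₜ∂ₛh` at `(z 0, z 1)` (complex). -/
def soloInformedCoonsPtc (z : Fin 2 → ℝ) : ℂ :=
  G' (soloInformedCoons cB cT cL cR (z 0) (z 1)) *
      soloInformedCoonsDt cB cT dL dR (z 0) (z 1) *
        soloInformedCoonsDs cB cT cL cR dB dT (z 0) (z 1) +
    G (soloInformedCoons cB cT cL cR (z 0) (z 1)) *
      soloInformedCoonsDst cB cT dB dT dL dR (z 0) (z 1)

/-- `∂ₛ(G(h)·∂ₜh) = G′(h) ∂ₛh ∂ₜh + G(h) ∂ₛ∂ₜh` at `(z 0, z 1)` (complex). -/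
def soloInformedCoonsQsc (z : Fin 2 → ℝ) : ℂ :=
  G' (soloInformedCoons cB cT cL cR (z 0) (z 1)) *
      soloInformedCoonsDs cB cT cL cR dB dT (z 0) (z 1) *
        soloInformedCoonsDt cB cT dL dR (z 0) (z 1) +
    G (soloInformedCoons cB cT cL cR (z 0) (z 1)) *
      soloInformedCoonsDst cB cT dB dT dL dR (z 0) (z 1)

end Defs

section Deriv

variable {G G' : ℂ → ℂ} {cB cT cL cR dB dT dL dR : ℝ → ℂ} {z : Fin 2 → ℝ}

/-- `0 ≠ 1` in `Fin 2`. -/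
private theorem fin2_zero_ne_one : (0 : Fin 2) ≠ 1 := by decide

/-- `1 ≠ 0` in `Fin 2`. -/
private theorem fin2_one_ne_zero : (1 : Fin 2) ≠ 0 := by decide

/-- **Closedness:** `∂ₜ(G(h)∂ₛh) = ∂ₛ(G(h)∂ₜh)` pointwise (complex form). -/
theorem soloInformed_coonsPtc_eq_Qsc (z : Fin 2 → ℝ) :
    soloInformedCoonsPtc G G' cB cT cL cR dB dT dL dR z =
      soloInformedCoonsQsc G G' cB cT cL cR dB dT dL dR z := by
  unfold soloInformedCoonsPtc soloInformedCoonsQsc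
  ring

/-- **`∂ₜ` of `Re(G(h)∂ₛh)` as a line derivative along `e₁`.**  Needs `G` differentiable at `h(z)`
and the left/right curves differentiable at `t = z 1`. -/
theorem soloInformed_hasLineDerivAt_re_coonsP
    (hG : HasDerivAt G (G' (soloInformedCoons cB cT cL cR (z 0) (z 1)))
      (soloInformedCoons cB cT cL cR (z 0) (z 1)))
    (hL : HasDerivAt cL (dL (z 1)) (z 1)) (hR : HasDerivAt cR (dR (z 1)) (z 1)) :
    HasLineDerivAt ℝ (fun w => (soloInformedCoonsPc G cB cT cL cR dB dT w).re)
      (soloInformedCoonsPtc G G' cB cT cL cR dB dT dL dR z).re z (Pi.single 1 1) := by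
  apply soloInformed_hasLineDerivAt_of_update
  have key : (fun u => (soloInformedCoonsPc G cB cT cL cR dB dT (Function.update z 1 u)).re) =
      fun u => (G (soloInformedCoons cB cT cL cR (z 0) u) *
        soloInformedCoonsDs cB cT cL cR dB dT (z 0) u).re := by
    ext u
    simp only [soloInformedCoonsPc, Function.update_self, Function.update_of_ne fin2_zero_ne_one]
  rw [key]
  exact soloInformed_hasDerivAt_re_comp_mul hG (soloInformed_hasDerivAt_coons_t (z 0) hL hR)
    (soloInformed_hasDerivAt_coonsDs_t (z 0) hL hR)

/-- `Im` version of `soloInformed_hasLineDerivAt_re_coonsP`. -/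
theorem soloInformed_hasLineDerivAt_im_coonsP
    (hG : HasDerivAt G (G' (soloInformedCoons cB cT cL cR (z 0) (z 1)))
      (soloInformedCoons cB cT cL cR (z 0) (z 1)))
    (hL : HasDerivAt cL (dL (z 1)) (z 1)) (hR : HasDerivAt cR (dR (z 1)) (z 1)) :
    HasLineDerivAt ℝ (fun w => (soloInformedCoonsPc G cB cT cL cR dB dT w).im)
      (soloInformedCoonsPtc G G' cB cT cL cR dB dT dL dR z).im z (Pi.single 1 1) := by
  apply soloInformed_hasLineDerivAt_of_update
  have key : (fun u => (soloInformedCoonsPc G cB cT cL cR dB dT (Function.update z 1 u)).im) =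
      fun u => (G (soloInformedCoons cB cT cL cR (z 0) u) *
        soloInformedCoonsDs cB cT cL cR dB dT (z 0) u).im := by
    ext u
    simp only [soloInformedCoonsPc, Function.update_self, Function.update_of_ne fin2_zero_ne_one]
  rw [key]
  exact soloInformed_hasDerivAt_im_comp_mul hG (soloInformed_hasDerivAt_coons_t (z 0) hL hR)
    (soloInformed_hasDerivAt_coonsDs_t (z 0) hL hR)

/-- **`∂ₛ` of `Re(G(h)∂ₜh)` as a line derivative along `e₀`.**  Needs `G` differentiable at `h(z)`
and the bottom/top curves differentiable at `s = z 0`. -/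
theorem soloInformed_hasLineDerivAt_re_coonsQ
    (hG : HasDerivAt G (G' (soloInformedCoons cB cT cL cR (z 0) (z 1)))
      (soloInformedCoons cB cT cL cR (z 0) (z 1)))
    (hB : HasDerivAt cB (dB (z 0)) (z 0)) (hT : HasDerivAt cT (dT (z 0)) (z 0)) :
    HasLineDerivAt ℝ (fun w => (soloInformedCoonsQc G cB cT cL cR dL dR w).re)
      (soloInformedCoonsQsc G G' cB cT cL cR dB dT dL dR z).re z (Pi.single 0 1) := by
  apply soloInformed_hasLineDerivAt_of_update
  have key : (fun u => (soloInformedCoonsQc G cB cT cL cR dL dR (Function.update z 0 u)).re) =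
      fun u => (G (soloInformedCoons cB cT cL cR u (z 1)) *
        soloInformedCoonsDt cB cT dL dR u (z 1)).re := by
    ext u
    simp only [soloInformedCoonsQc, Function.update_self, Function.update_of_ne fin2_one_ne_zero]
  rw [key]
  exact soloInformed_hasDerivAt_re_comp_mul hG (soloInformed_hasDerivAt_coons_s (z 1) hB hT)
    (soloInformed_hasDerivAt_coonsDt_s (z 1) hB hT)

/-- `Im` version of `soloInformed_hasLineDerivAt_re_coonsQ`. -/
theorem soloInformed_hasLineDerivAt_im_coonsQ
    (hG : HasDerivAt G (G' (soloInformedCoons cB cT cL cR (z 0) (z 1)))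
      (soloInformedCoons cB cT cL cR (z 0) (z 1)))
    (hB : HasDerivAt cB (dB (z 0)) (z 0)) (hT : HasDerivAt cT (dT (z 0)) (z 0)) :
    HasLineDerivAt ℝ (fun w => (soloInformedCoonsQc G cB cT cL cR dL dR w).im)
      (soloInformedCoonsQsc G G' cB cT cL cR dB dT dL dR z).im z (Pi.single 0 1) := by
  apply soloInformed_hasLineDerivAt_of_update
  have key : (fun u => (soloInformedCoonsQc G cB cT cL cR dL dR (Function.update z 0 u)).im) =
      fun u => (G (soloInformedCoons cB cT cL cR u (z 1)) *
        soloInformedCoonsDt cB cT dL dR u (z 1)).im := by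
    ext u
    simp only [soloInformedCoonsQc, Function.update_self, Function.update_of_ne fin2_one_ne_zero]
  rw [key]
  exact soloInformed_hasDerivAt_im_comp_mul hG (soloInformed_hasDerivAt_coons_s (z 1) hB hT)
    (soloInformed_hasDerivAt_coonsDt_s (z 1) hB hT)

/-- **`Pₜ = Qₛ` everywhere** (real parts): the `hclosed` hypothesis of
`soloInformed_kzGreen_line`. -/
theorem soloInformed_coonsPt_eqOn_Qs (S : Set (Fin 2 → ℝ)) :
    EqOn (fun w => (soloInformedCoonsPtc G G' cB cT cL cR dB dT dL dR w).re)
      (fun w => (soloInformedCoonsQsc G G' cB cT cL cR dB dT dL dR w).re) S :=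
  fun w _ => by simp only [soloInformed_coonsPtc_eq_Qsc]

/-- `Im` version of `soloInformed_coonsPt_eqOn_Qs`. -/
theorem soloInformed_coonsPt_eqOn_Qs_im (S : Set (Fin 2 → ℝ)) :
    EqOn (fun w => (soloInformedCoonsPtc G G' cB cT cL cR dB dT dL dR w).im)
      (fun w => (soloInformedCoonsQsc G G' cB cT cL cR dB dT dL dR w).im) S :=
  fun w _ => by simp only [soloInformed_coonsPtc_eq_Qsc]

end Deriv

end Summit.KontsevichZagierPeriods.KontsevichZagierPeriods.Theorems
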